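/- Free lead seat `ym-line-cbag-p1` (prover-ym-line-cbag-p1-g20-0; own crux `BoxFloorAllGroups` stmt-QuantumFields-22254 CLOSED) on the
planner-of-record's LINE 5, route `HankelDensitySplitting`, crux `HankelDensityFloor` (stmt-QuantumFields-26618), registered stub 3
`stub_hankelLogConvex` — I: reflection positivity on the torus for the COMPOSITE (six-plane) axial observables.  Helper file (`--supports
stmt-QuantumFields-26618`).  RECORD-type material; the Yang–Mills mass gap is NOT proved by anything here. -/
import Summits.QuantumFields.YangMills.Theorems.DirichletWindowAxialLogConvexityLimit
import HarnessLib

/-!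
# `HankelLogConvex` (stub 3 of crux `HankelDensityFloor`, route `HankelDensitySplitting`) — I: the torus

The composite twin of `DirichletWindowAxialLogConvexityTorus` (which treats ONE temporal axial plaquette).  On the torus `(ℤ/Mℤ)⁴` with
Wilson's measure `μ_{β,M}` let `P(c, q) = Re tr ρ(U_{(c e₀, q)})` be the plaquette at the axial site `c e₀` in the coordinate plane `q`, and
`s(q) = 0` for the three temporal planes (`q ∋ e₀`), `s(q) = 1` for the three spatial ones.  The REFLECTION-PAIRED torus correlator is

`F_M(n) = Σ_q Σ_{q'} Cov_{β,M}(P(0, q), P(n − s(q), q'))`  (`= t_M(n) + g_M(n−1)`, the torus version of the crux's `hF`),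

introduced through a characterising hypothesis `hF` (no definition).  Composite axial observables `E_σ(a) = Σ_q P(a + σ(q), q)` with
`σ = 0` (the density `tr F²` at `a e₀`) and `σ = s` (the density with its spatial plaquettes one step UP).

* Reflections of axial plaquettes in every plane (`plaq_timeReflect`, `plaq_negReflect`): the link reflection `t ↦ 1 − t` sends
  `P(c,q) ↦ P(s(q) − c, q)`, the site reflection `t ↦ −t` sends `P(c,q) ↦ P(s(q) − c − 1, q)`.
* Translation invariance (`cov_plaq_axis`) and the GRAM IDENTITIES: `Cov(E_0(a)∘θ_link, E_0(b)) = F_M(a+b)` (`gram_link`),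
  `Cov(E_0(a)∘θ_site, E_0(b)) = F_M(a+b+1)` (`gram_site`), `Cov(E_s(a)∘θ_link, E_s(b)) = F_M(−(a+b))` (`gram_top`; at the top of an odd
  torus `2S+1`, `a = S−α`, `b = S−β`, this is `F_M(α+β+1)`).
* Measurability, boundedness and the cylinder property of the composite axial observables (`measurable_comp`, `bounded_comp`,
  `dependsOn_comp`).  The reflection-positive cones are applied in the sequel `…LogConvexCones`.

References: K. Osterwalder, E. Seiler, Ann. Phys. 110 (1978) 440, §2; E. Seiler, LNP 159 (1982) Ch. 2; J. Fröhlich, R. Israel, E. Lieb,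
B. Simon, CMP 62 (1978) 1.  NOT the Yang–Mills mass gap; not the crux `HankelDensityFloor` either.
-/

noncomputable section

open MeasureTheory ProbabilityTheory Filter Topology
open scoped ComplexOrder
open Literature.MathematicalPhysics.QuantumFieldTheory
open Summit.QuantumFields.YangMills.Theorems.FiniteSusceptibilityWeakCoupling

namespace Summit.QuantumFields.YangMills.Theorems.HankelDensitySplitting

namespace LogConvex

variable {G : Type*} [Group G] [TopologicalSpace G] [IsTopologicalGroup G] [CompactSpace G]
  [MeasurableSpace G] [BorelSpace G] {N : ℕ} (ρ : G →* Matrix (Fin N) (Fin N) ℂ)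

section Torus

variable {M : ℕ}

/-! ### Axial sites and plaquettes under the two reflections -/

/-- The link reflection `t ↦ 1 − t` on axial sites: `(c e₀)ᶿ = (1 − c) e₀`. [folklore] -/
theorem timeReflect_axis (c : ZMod M) : Site.timeReflect (Pi.single 0 c : Site 4 M) = Pi.single 0 (1 - c) := by
  funext k
  by_cases hk : k = 0
  · subst hk
    rw [WilsonRP.timeReflect_apply_zero, AxialLogConvexity.axis_apply_zero, AxialLogConvexity.axis_apply_zero]
  · rw [WilsonRP.timeReflect_apply_of_ne _ hk, AxialLogConvexity.axis_apply_of_ne c hk,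
      AxialLogConvexity.axis_apply_of_ne _ hk]

/-- The site reflection `t ↦ −t` on axial sites: `(c e₀)ᶿ' = (−c) e₀`. [folklore] -/
theorem negReflect_axis (c : ZMod M) : Site.negReflect (Pi.single 0 c : Site 4 M) = Pi.single 0 (-c) := by
  funext k
  by_cases hk : k = 0
  · subst hk
    rw [WilsonSiteRP.negReflect_apply_zero, AxialLogConvexity.axis_apply_zero, AxialLogConvexity.axis_apply_zero]
  · rw [WilsonSiteRP.negReflect_apply_of_ne _ hk, AxialLogConvexity.axis_apply_of_ne c hk,
      AxialLogConvexity.axis_apply_of_ne _ hk]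

variable {q : {p : Fin 4 × Fin 4 // p.1 < p.2}}

omit [MeasurableSpace G] [BorelSpace G] in
/-- **Axial plaquettes under the link reflection**, every plane: `P_{(c;q)}(ΘU) = P_{(s(q) − c; q)}(U)` with `s(q) = 0` for temporal and
`s(q) = 1` for spatial planes (temporal plaquettes `[c, c+1] ↦ [−c, −c+1]`, spatial ones at time `c ↦ 1 − c`). [folklore] -/
theorem plaq_timeReflect (hρ : Continuous ρ) (c : ZMod M) (U : GaugeConfig 4 M G) :
    WilsonRP.plaqRe ρ U.timeReflect ((Pi.single 0 c : Site 4 M), q) =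
      WilsonRP.plaqRe ρ U (Pi.single 0 ((if q.1.1 = 0 then (0 : ZMod M) else 1) - c), q) := by
  by_cases hq : q.1.1 = 0
  · rw [AxialLogConvexity.tplaq_timeReflect ρ hρ hq, if_pos hq, zero_sub]
  · rw [WilsonRP.plaqRe_timeReflect ρ hρ, if_neg hq]
    unfold WilsonRP.plaqReflect
    rw [if_neg (show ¬ ((((Pi.single 0 c : Site 4 M), q) : Plaquette 4 M).2.1.1 = 0) from hq)]
    show WilsonRP.plaqRe ρ U (Site.timeReflect (Pi.single 0 c : Site 4 M), q) = _
    rw [timeReflect_axis]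

omit [MeasurableSpace G] [BorelSpace G] in
/-- **Axial plaquettes under the site reflection**, every plane: `P_{(c;q)}(Θ'U) = P_{(s(q) − c − 1; q)}(U)` (temporal plaquettes
`[c, c+1] ↦ [−c−1, −c]`, spatial ones at time `c ↦ −c`). [folklore] -/
theorem plaq_negReflect (hρ : Continuous ρ) (c : ZMod M) (U : GaugeConfig 4 M G) :
    WilsonRP.plaqRe ρ U.negReflect ((Pi.single 0 c : Site 4 M), q) =
      WilsonRP.plaqRe ρ U (Pi.single 0 ((if q.1.1 = 0 then (0 : ZMod M) else 1) - c - 1), q) := by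
  by_cases hq : q.1.1 = 0
  · rw [AxialLogConvexity.tplaq_negReflect ρ hρ hq, if_pos hq]
    congr 3
    ring
  · rw [WilsonSiteRP.plaqRe_negReflect ρ hρ, if_neg hq]
    unfold WilsonSiteRP.sitePlaqReflect
    rw [if_neg (show ¬ ((((Pi.single 0 c : Site 4 M), q) : Plaquette 4 M).2.1.1 = 0) from hq)]
    show WilsonRP.plaqRe ρ U (Site.negReflect (Pi.single 0 c : Site 4 M), q) = _
    rw [negReflect_axis]
    congr 3
    ring

variable [NeZero M]

/-! ### Translation invariance of plaquette-pair covariances (any two planes) -/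

/-- `Cov(P_{(x,q)}, P_{(y,q')}) = Cov(P_{(x−v,q)}, P_{(y−v,q')})`. [folklore] -/
theorem cov_plaq_shift (β : ℝ) (q q' : {p : Fin 4 × Fin 4 // p.1 < p.2}) (x y v : Site 4 M) :
    cov[fun U => WilsonRP.plaqRe ρ U (x, q), fun U => WilsonRP.plaqRe ρ U (y, q');
        wilsonMeasure (d := 4) (L := M) ρ β] =
      cov[fun U => WilsonRP.plaqRe ρ U (x - v, q), fun U => WilsonRP.plaqRe ρ U (y - v, q');
        wilsonMeasure (d := 4) (L := M) ρ β] := by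
  conv_lhs => rw [← wilsonMeasure_map_torusConfigShift ρ β v]
  rw [covariance_map_equiv]
  simp only [Function.comp_def, AxialLogConvexity.tplaq_torusConfigShift]

/-- Axial form: `Cov(P(a,q), P(b,q')) = Cov(P(0,q), P(b − a, q'))`. [folklore] -/
theorem cov_plaq_axis (β : ℝ) (q q' : {p : Fin 4 × Fin 4 // p.1 < p.2}) (a b : ZMod M) :
    cov[fun U => WilsonRP.plaqRe ρ U ((Pi.single 0 a : Site 4 M), q),
        fun U => WilsonRP.plaqRe ρ U ((Pi.single 0 b : Site 4 M), q'); wilsonMeasure (d := 4) (L := M) ρ β] =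
      cov[fun U => WilsonRP.plaqRe ρ U ((Pi.single 0 0 : Site 4 M), q),
        fun U => WilsonRP.plaqRe ρ U ((Pi.single 0 (b - a) : Site 4 M), q'); wilsonMeasure (d := 4) (L := M) ρ β] := by
  rw [cov_plaq_shift ρ β q q' _ _ (Pi.single 0 a : Site 4 M), AxialLogConvexity.axis_sub_axis,
    AxialLogConvexity.axis_sub_axis, sub_self]

/-- Symmetry: `Cov(P(0,q), P(c,q')) = Cov(P(0,q'), P(−c,q))`. [folklore] -/
theorem cov_plaq_axis_symm (β : ℝ) (q q' : {p : Fin 4 × Fin 4 // p.1 < p.2}) (c : ZMod M) :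
    cov[fun U => WilsonRP.plaqRe ρ U ((Pi.single 0 0 : Site 4 M), q),
        fun U => WilsonRP.plaqRe ρ U ((Pi.single 0 c : Site 4 M), q'); wilsonMeasure (d := 4) (L := M) ρ β] =
      cov[fun U => WilsonRP.plaqRe ρ U ((Pi.single 0 0 : Site 4 M), q'),
        fun U => WilsonRP.plaqRe ρ U ((Pi.single 0 (-c) : Site 4 M), q); wilsonMeasure (d := 4) (L := M) ρ β] := by
  rw [covariance_comm, cov_plaq_axis ρ β q' q c 0, zero_sub]

/-! ### The reflection-paired torus correlator `F_M` and the Gram identities -/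

variable {β : ℝ} {F : ZMod M → ℝ}
  (hF : ∀ n : ZMod M, F n = ∑ q : {p : Fin 4 × Fin 4 // p.1 < p.2}, ∑ q' : {p : Fin 4 × Fin 4 // p.1 < p.2},
    cov[fun U => WilsonRP.plaqRe ρ U ((Pi.single 0 0 : Site 4 M), q),
      fun U => WilsonRP.plaqRe ρ U ((Pi.single 0 (n - (if q.1.1 = 0 then (0 : ZMod M) else 1)) : Site 4 M), q');
      wilsonMeasure (d := 4) (L := M) ρ β])
include hF

/-- **Gram identity, link reflection, bottom family**: `Cov(E_0(a)∘Θ, E_0(b)) = F_M(a + b)` where `E_0(a) = Σ_q P(a, q)` is the six-plane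
density at `a e₀` and `Θ` the link reflection `t ↦ 1 − t`. [folklore] -/
theorem gram_link (hρ : Continuous ρ) (a b : ZMod M) :
    cov[fun U => ∑ q : {p : Fin 4 × Fin 4 // p.1 < p.2}, WilsonRP.plaqRe ρ U.timeReflect ((Pi.single 0 a : Site 4 M), q),
        fun U => ∑ q : {p : Fin 4 × Fin 4 // p.1 < p.2}, WilsonRP.plaqRe ρ U ((Pi.single 0 b : Site 4 M), q);
        wilsonMeasure (d := 4) (L := M) ρ β] = F (a + b) := by
  haveI := isProbabilityMeasure_wilsonMeasure (d := 4) (L := M) ρ hρ β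
  simp only [plaq_timeReflect ρ hρ]
  rw [covariance_fun_sum_left (fun q => AxialLogConvexity.memLp_tplaq ρ hρ β _)
    (memLp_finsetSum _ fun _ _ => AxialLogConvexity.memLp_tplaq ρ hρ β _), hF (a + b)]
  refine Finset.sum_congr rfl fun q _ => ?_
  rw [covariance_fun_sum_right (fun q' => AxialLogConvexity.memLp_tplaq ρ hρ β _) (AxialLogConvexity.memLp_tplaq ρ hρ β _)]
  refine Finset.sum_congr rfl fun q' _ => ?_
  rw [cov_plaq_axis ρ β]
  congr 3
  ring

/-- **Gram identity, site reflection**: `Cov(E_0(a)∘Θ', E_0(b)) = F_M(a + b + 1)`, `Θ'` the site reflection `t ↦ −t`. [folklore] -/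
theorem gram_site (hρ : Continuous ρ) (a b : ZMod M) :
    cov[fun U => ∑ q : {p : Fin 4 × Fin 4 // p.1 < p.2}, WilsonRP.plaqRe ρ U.negReflect ((Pi.single 0 a : Site 4 M), q),
        fun U => ∑ q : {p : Fin 4 × Fin 4 // p.1 < p.2}, WilsonRP.plaqRe ρ U ((Pi.single 0 b : Site 4 M), q);
        wilsonMeasure (d := 4) (L := M) ρ β] = F (a + b + 1) := by
  haveI := isProbabilityMeasure_wilsonMeasure (d := 4) (L := M) ρ hρ β
  simp only [plaq_negReflect ρ hρ]
  rw [covariance_fun_sum_left (fun q => AxialLogConvexity.memLp_tplaq ρ hρ β _)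
    (memLp_finsetSum _ fun _ _ => AxialLogConvexity.memLp_tplaq ρ hρ β _), hF (a + b + 1)]
  refine Finset.sum_congr rfl fun q _ => ?_
  rw [covariance_fun_sum_right (fun q' => AxialLogConvexity.memLp_tplaq ρ hρ β _) (AxialLogConvexity.memLp_tplaq ρ hρ β _)]
  refine Finset.sum_congr rfl fun q' _ => ?_
  rw [cov_plaq_axis ρ β]
  congr 3
  ring

/-- **Gram identity, link reflection, top family**: for the flipped density `E_s(a) = Σ_q P(a + s(q), q)` (spatial plaquettes one step up),
`Cov(E_s(a)∘Θ, E_s(b)) = F_M(−(a + b))` (covariance symmetry turns the second plane's offset into the first plane's).  At the top of an odd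
torus `M = 2S+1`, `a = S − α`, `b = S − β`, this reads `F_M(α + β + 1)`. [folklore] -/
theorem gram_top (hρ : Continuous ρ) (a b : ZMod M) :
    cov[fun U => ∑ q : {p : Fin 4 × Fin 4 // p.1 < p.2},
          WilsonRP.plaqRe ρ U.timeReflect ((Pi.single 0 (a + (if q.1.1 = 0 then (0 : ZMod M) else 1)) : Site 4 M), q),
        fun U => ∑ q : {p : Fin 4 × Fin 4 // p.1 < p.2},
          WilsonRP.plaqRe ρ U ((Pi.single 0 (b + (if q.1.1 = 0 then (0 : ZMod M) else 1)) : Site 4 M), q);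
        wilsonMeasure (d := 4) (L := M) ρ β] = F (-(a + b)) := by
  haveI := isProbabilityMeasure_wilsonMeasure (d := 4) (L := M) ρ hρ β
  simp only [plaq_timeReflect ρ hρ]
  rw [covariance_fun_sum_left (fun q => AxialLogConvexity.memLp_tplaq ρ hρ β _)
    (memLp_finsetSum _ fun _ _ => AxialLogConvexity.memLp_tplaq ρ hρ β _), hF (-(a + b)), Finset.sum_comm]
  refine Finset.sum_congr rfl fun q' _ => ?_
  rw [covariance_fun_sum_right (fun q => AxialLogConvexity.memLp_tplaq ρ hρ β _) (AxialLogConvexity.memLp_tplaq ρ hρ β _)]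
  refine Finset.sum_congr rfl fun q _ => ?_
  rw [cov_plaq_axis ρ β, cov_plaq_axis_symm ρ β]
  congr 3
  ring

/-! ### Composite observables: measurability, bounds, cones -/

omit [CompactSpace G] [NeZero M] hF in
/-- A composite axial observable `Σ_q P(c(q), q)` is measurable. [folklore] -/
theorem measurable_comp (hρ : Continuous ρ) (c : {p : Fin 4 × Fin 4 // p.1 < p.2} → ZMod M) :
    Measurable fun U : GaugeConfig 4 M G =>
      ∑ q : {p : Fin 4 × Fin 4 // p.1 < p.2}, WilsonRP.plaqRe ρ U ((Pi.single 0 (c q) : Site 4 M), q) :=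
  Finset.measurable_sum _ fun _ _ => WilsonRP.measurable_plaqRe ρ hρ _

omit [MeasurableSpace G] [BorelSpace G] [NeZero M] hF in
/-- A composite axial observable is bounded. [folklore] -/
theorem bounded_comp (hρ : Continuous ρ) (c : {p : Fin 4 × Fin 4 // p.1 < p.2} → ZMod M) :
    ∃ C : ℝ, ∀ U : GaugeConfig 4 M G,
      |∑ q : {p : Fin 4 × Fin 4 // p.1 < p.2}, WilsonRP.plaqRe ρ U ((Pi.single 0 (c q) : Site 4 M), q)| ≤ C :=
  ⟨∑ _q : {p : Fin 4 × Fin 4 // p.1 < p.2}, (N : ℝ), fun U =>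
    (Finset.abs_sum_le_sum_abs _ _).trans (Finset.sum_le_sum fun _ _ => WilsonRP.abs_plaqRe_le ρ hρ U _)⟩

omit [TopologicalSpace G] [IsTopologicalGroup G] [CompactSpace G] [MeasurableSpace G] [BorelSpace G] [NeZero M] hF in
/-- A composite axial observable depends only on a set of links containing the links of its plaquettes. [folklore] -/
theorem dependsOn_comp {s : Set (Edge 4 M)} (c : {p : Fin 4 × Fin 4 // p.1 < p.2} → ZMod M)
    (h : ∀ q : {p : Fin 4 × Fin 4 // p.1 < p.2},
      DependsOn (fun U : GaugeConfig 4 M G => WilsonRP.plaqRe ρ U ((Pi.single 0 (c q) : Site 4 M), q)) s) :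
    DependsOn (fun U : GaugeConfig 4 M G =>
      ∑ q : {p : Fin 4 × Fin 4 // p.1 < p.2}, WilsonRP.plaqRe ρ U ((Pi.single 0 (c q) : Site 4 M), q)) s :=
  fun _ _ hUV => Finset.sum_congr rfl fun q _ => h q hUV

/-- The diagonal entries of the bottom Gram family are the even values `F_M(a + a)` (the case `b = a` of `gram_link`). [folklore] -/
theorem gram_link_diag (hρ : Continuous ρ) (a : ZMod M) :
    cov[fun U => ∑ q : {p : Fin 4 × Fin 4 // p.1 < p.2}, WilsonRP.plaqRe ρ U.timeReflect ((Pi.single 0 a : Site 4 M), q),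
        fun U => ∑ q : {p : Fin 4 × Fin 4 // p.1 < p.2}, WilsonRP.plaqRe ρ U ((Pi.single 0 a : Site 4 M), q);
        wilsonMeasure (d := 4) (L := M) ρ β] = F (a + a) :=
  gram_link ρ hF hρ a a

end Torus

end LogConvex

end Summit.QuantumFields.YangMills.Theorems.HankelDensitySplitting

end
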